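import Mathlib

/-!
# The Möbius-ladder MAX-CUT instance of E-73 has a closed-form optimum: `maxcut(M_{2k}) = 3k − 2` for `k` even

Cell `pub-qadeq` (summit `QuantumAdvantage`), CLAIMS row E-73 (Wang et al., ‘Quantum-Boosted
High-Fidelity Deep Learning’, arXiv:2508.11190v1, Fig. 2c: the QBoson Tiangong coherent Ising machine
"solving a MAX-CUT problem of a 1000-node Möbius ladder graph … consistently achieves the theoretical
best solution (1498)").  LANE RECEIPT (our own elementary lemma, hence under `Summits/`, like
`QuadratizedPairMinimum.lean`): the instance family is closed-form — for an EVEN number `k ≥ 2` of rungs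
the Möbius ladder `M_{2k}` (the cycle `C_{2k}` on `0, …, 2k−1` plus the `k` rungs `{i, i+k}`, `3k`
edges) has maximum cut exactly `3k − 2`; in particular the 1000-node instance (`k = 500`) has optimum
`1498`, attained by an explicit two-colouring.  Nothing here is a statement about any device or
solver.
HONEST FRAMING: instance-level adjudication of specific advantage claims; no claim about BQP vs BPP
or the summit.

## Contents (all proved; 0 facts, 0 sorry)

* `cycleCut k x`, `rungCut k x`, `cut k x` — for a two-colouring `x : ℕ → Bool` read periodically
  (vertex `i` has colour `x (i % (2k))`), the number of cut cycle edges `{i, i+1}` (`i < 2k`, indices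
  mod `2k`), of cut rungs `{i, i+k}` (`i < k`), and their sum; `cut_le : cut k x ≤ 3k`.
* `changes_parity` — along any closed walk the number of colour changes is even (telescoping XOR).
* `walk_bound`, `cut_le_of_even` — for even `k ≥ 2` every colouring leaves at least TWO of the
  `3k` edges uncut (the closed walks `0 → 1 → ⋯ → k → 0`, `k → k+1 → ⋯ → 2k ≡ 0 → k` and
  `1 → ⋯ → k+1 → 1` have odd length `k + 1`, so each contains an uncut edge, and no single edge lies
  on all three); hence `cut_le_of_even : cut k x ≤ 3k − 2`.
* `altColouring k` — colour `i mod 2` on the first half and `(i+1) mod 2` on the second half;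
  `cut_altColouring : cut k (altColouring k) = 3k − 2` for even `k ≥ 2` (all rungs and all but the two
  cycle edges `{k−1, k}`, `{2k−1, 0}` are cut).
* `maxCut k := max over the 2^{2k} colourings`, **`maxCut_eq : maxCut k = 3k − 2`** (`k` even, `k ≥ 2`),
  and **`maxCut_mobius_1000 : maxCut 500 = 1498`** — the printed "theoretical best solution (1498)".
-/

namespace Summit.QuantumAdvantage.Dequantization.MobiusLadderMaxCut

open Finset

/-! ### 1. The cut of a colouring -/

/-- Indicator of a colour change between two Boolean colours, as a natural number. -/
def chg (a b : Bool) : ℕ := if a = b then 0 else 1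

/-- A change indicator is `0` or `1`. -/
theorem chg_le_one (a b : Bool) : chg a b ≤ 1 := by
  unfold chg; split_ifs <;> simp

/-- The change indicator is symmetric. -/
theorem chg_comm (a b : Bool) : chg a b = chg b a := by
  unfold chg; cases a <;> cases b <;> rfl

/-- Colour of vertex `i` under the colouring `x`, read periodically with period `2k`. -/
def col (k : ℕ) (x : ℕ → Bool) (i : ℕ) : Bool := x (i % (2 * k))

/-- Colours are read with period `2k`. -/
theorem col_add_period (k : ℕ) (x : ℕ → Bool) (i : ℕ) : col k x (i + 2 * k) = col k x i := by
  simp [col]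

/-- Number of cut CYCLE edges `{i, i+1}`, `i = 0, …, 2k−1` (indices mod `2k`). -/
def cycleCut (k : ℕ) (x : ℕ → Bool) : ℕ :=
  ∑ i ∈ range (2 * k), chg (col k x i) (col k x (i + 1))

/-- Number of cut RUNGS `{i, i+k}`, `i = 0, …, k−1`. -/
def rungCut (k : ℕ) (x : ℕ → Bool) : ℕ :=
  ∑ i ∈ range k, chg (col k x i) (col k x (i + k))

/-- The cut value of the colouring `x` on the Möbius ladder `M_{2k}`. -/
def cut (k : ℕ) (x : ℕ → Bool) : ℕ := cycleCut k x + rungCut k x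

/-- At most `2k` cycle edges are cut. -/
theorem cycleCut_le (k : ℕ) (x : ℕ → Bool) : cycleCut k x ≤ 2 * k := by
  unfold cycleCut
  calc ∑ i ∈ range (2 * k), chg (col k x i) (col k x (i + 1))
      ≤ ∑ i ∈ range (2 * k), 1 := sum_le_sum fun i _ => chg_le_one _ _
    _ = 2 * k := by simp

/-- At most `k` rungs are cut. -/
theorem rungCut_le (k : ℕ) (x : ℕ → Bool) : rungCut k x ≤ k := by
  unfold rungCut
  calc ∑ i ∈ range k, chg (col k x i) (col k x (i + k))
      ≤ ∑ i ∈ range k, 1 := sum_le_sum fun i _ => chg_le_one _ _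
    _ = k := by simp

/-- A Möbius ladder with `k` rungs has `3k` edges, so every cut is at most `3k`. -/
theorem cut_le (k : ℕ) (x : ℕ → Bool) : cut k x ≤ 3 * k := by
  have h1 := cycleCut_le k x
  have h2 := rungCut_le k x
  unfold cut; omega

/-! ### 2. Parity of colour changes along a closed walk -/

/-- Along a walk `g 0, g 1, …, g m` the number of colour changes has the parity of `chg (g 0) (g m)`;
in particular it is even on a closed walk. -/
theorem changes_parity (g : ℕ → Bool) (m : ℕ) :
    Even (∑ t ∈ range m, chg (g t) (g (t + 1)) + chg (g 0) (g m)) := by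
  induction m with
  | zero => simp [chg]
  | succ m ih =>
    rw [sum_range_succ]
    -- `ih : Even (S + chg (g 0) (g m))`; the three pairwise changes among g 0, g m, g (m+1) sum to even
    have h3 : Even (chg (g 0) (g m) + chg (g m) (g (m + 1)) + chg (g 0) (g (m + 1))) := by
      unfold chg
      cases g 0 <;> cases g m <;> cases g (m + 1) <;> decide
    have := Even.add ih h3
    -- rearrange: (S + c0m) + (c0m + cm + c0') = (S + cm + c0') + 2 c0m
    have e : ∑ t ∈ range m, chg (g t) (g (t + 1)) + chg (g 0) (g m) +
        (chg (g 0) (g m) + chg (g m) (g (m + 1)) + chg (g 0) (g (m + 1)))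
        = (∑ t ∈ range m, chg (g t) (g (t + 1)) + chg (g m) (g (m + 1)) + chg (g 0) (g (m + 1)))
          + 2 * chg (g 0) (g m) := by ring
    rw [e] at this
    exact (Nat.even_add.1 this).2 (even_two_mul _)

/-- On a closed walk of ODD length `m` (so `g m = g 0`) at least one step is NOT a colour change. -/
theorem exists_uncut_of_odd_closed (g : ℕ → Bool) (m : ℕ) (hm : Odd m) (hclosed : g m = g 0) :
    ∑ t ∈ range m, chg (g t) (g (t + 1)) + 1 ≤ m := by
  have hpar := changes_parity g m
  rw [hclosed] at hpar
  simp only [chg, if_true, add_zero] at hpar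
  have hle : ∑ t ∈ range m, chg (g t) (g (t + 1)) ≤ m := by
    calc ∑ t ∈ range m, chg (g t) (g (t + 1)) ≤ ∑ t ∈ range m, 1 := sum_le_sum fun t _ => chg_le_one _ _
      _ = m := by simp
  rcases Nat.lt_or_ge (∑ t ∈ range m, chg (g t) (g (t + 1))) m with hlt | hge
  · omega
  · exfalso
    have heq : ∑ t ∈ range m, (if g t = g (t + 1) then 0 else 1) = m := by
      have : ∑ t ∈ range m, chg (g t) (g (t + 1)) = m := le_antisymm hle hge
      simpa [chg] using this
    rw [heq] at hpar
    exact (Nat.not_even_iff_odd.2 hm) hpar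

/-! ### 3. Every colouring of `M_{2k}`, `k` even, leaves at least two edges uncut -/

/-- A sum of change-indicators over a range is at most the number of terms. -/
theorem sum_chg_range_le (f g : ℕ → Bool) (m : ℕ) :
    ∑ i ∈ range m, chg (f i) (g i) ≤ m := by
  calc ∑ i ∈ range m, chg (f i) (g i) ≤ ∑ i ∈ range m, 1 := sum_le_sum fun i _ => chg_le_one _ _
    _ = m := by simp

/-- Walk `a, a+1, …, a+k, a` (the path of `k` cycle edges from `a` closed by the rung `{a, a+k}`): for
even `k` it has odd length `k + 1`, so its `k` cycle edges and the rung are not all cut. -/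
theorem walk_bound (k : ℕ) (hk : Even k) (x : ℕ → Bool) (a : ℕ) :
    ∑ t ∈ range k, chg (col k x (a + t)) (col k x (a + t + 1)) + chg (col k x a) (col k x (a + k))
      ≤ k := by
  -- the closed walk g: t ↦ col (a+t) for t ≤ k, then back to col a
  set g : ℕ → Bool := fun t => if t ≤ k then col k x (a + t) else col k x a with hg
  have hodd : Odd (k + 1) := Even.add_one hk
  have hclosed : g (k + 1) = g 0 := by simp [hg]
  have h := exists_uncut_of_odd_closed g (k + 1) hodd hclosed
  rw [sum_range_succ] at h
  have e1 : ∑ t ∈ range k, chg (g t) (g (t + 1))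
      = ∑ t ∈ range k, chg (col k x (a + t)) (col k x (a + t + 1)) := by
    refine sum_congr rfl fun t ht => ?_
    have ht' : t < k := mem_range.1 ht
    simp [hg, show t ≤ k by omega, show t + 1 ≤ k by omega, add_assoc]
  have e2 : chg (g k) (g (k + 1)) = chg (col k x a) (col k x (a + k)) := by
    simp [hg, chg_comm]
  rw [e1, e2] at h
  omega

/-- **At least two uncut edges.** For even `k ≥ 2` every two-colouring cuts at most `3k − 2` of the
`3k` edges of the Möbius ladder `M_{2k}`. -/
theorem cut_le_of_even (k : ℕ) (hk : Even k) (hk2 : 2 ≤ k) (x : ℕ → Bool) :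
    cut k x ≤ 3 * k - 2 := by
  -- abbreviations for the edge indicators
  set C : ℕ → ℕ := fun i => chg (col k x i) (col k x (i + 1)) with hC
  set R : ℕ → ℕ := fun i => chg (col k x i) (col k x (i + k)) with hR
  have hcycle : cycleCut k x = ∑ i ∈ range (2 * k), C i := rfl
  have hrung : rungCut k x = ∑ i ∈ range k, R i := rfl
  -- (A) walk from 0:  Σ_{t<k} C t + R 0 ≤ k
  have hA : ∑ t ∈ range k, C t + R 0 ≤ k := by
    have h := walk_bound k hk x 0
    simp only [zero_add] at h
    simpa [hC, hR] using h
  -- (B) walk from k:  Σ_{t<k} C (k+t) + R 0 ≤ k   (the rung {k, 2k} is the rung {0, k} by periodicity)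
  have hB : ∑ t ∈ range k, C (k + t) + R 0 ≤ k := by
    have h := walk_bound k hk x k
    have hper : col k x (k + k) = col k x 0 := by
      rw [show k + k = 0 + 2 * k by ring, col_add_period]
    rw [hper, chg_comm] at h
    simpa [hC, hR, add_assoc] using h
  -- (C) walk from 1:  Σ_{t<k} C (1+t) + R 1 ≤ k
  have hC1 : ∑ t ∈ range k, C (1 + t) + R 1 ≤ k := by
    have h := walk_bound k hk x 1
    simpa [hC, hR, add_assoc, add_comm 1 k] using h
  -- range splittings
  have split1 : ∑ i ∈ range (2 * k), C i = ∑ t ∈ range k, C t + ∑ t ∈ range k, C (k + t) := by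
    rw [two_mul, sum_range_add]
  have split2 : ∑ i ∈ range (2 * k), C i
      = C 0 + ∑ t ∈ range k, C (1 + t) + ∑ t ∈ range (k - 1), C (k + 1 + t) := by
    have e : 2 * k = (k + (k - 1)) + 1 := by omega
    rw [e, sum_range_succ', sum_range_add]
    simp only [add_comm _ 1, ← add_assoc]
    ring_nf
  have splitR : ∑ i ∈ range k, R i = R 0 + R 1 + ∑ t ∈ range (k - 2), R (t + 2) := by
    have e : k = (k - 2) + 1 + 1 := by omega
    conv_lhs => rw [e, sum_range_succ', sum_range_succ']
    ring
  -- elementary bounds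
  have bC0 : C 0 ≤ 1 := chg_le_one _ _
  have bR0 : R 0 ≤ 1 := chg_le_one _ _
  have bR1 : R 1 ≤ 1 := chg_le_one _ _
  have bS1 : ∑ t ∈ range k, C t ≤ k := sum_chg_range_le _ _ _
  have bS2 : ∑ t ∈ range k, C (k + t) ≤ k := sum_chg_range_le _ _ _
  have bS3 : ∑ t ∈ range (k - 1), C (k + 1 + t) ≤ k - 1 := sum_chg_range_le _ _ _
  have bS4 : ∑ t ∈ range k, C (1 + t) ≤ k := sum_chg_range_le _ _ _
  have bSR : ∑ t ∈ range (k - 2), R (t + 2) ≤ k - 2 := sum_chg_range_le _ _ _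
  unfold cut
  rw [hcycle, hrung]
  omega

/-! ### 4. An optimal colouring: alternate on each half, shifted by one on the second half -/

/-- The colouring `i ↦ i mod 2` on the first half `0 … k−1` and `i ↦ (i+1) mod 2` on the second half
`k … 2k−1` (read periodically). -/
def altColouring (k : ℕ) (i : ℕ) : Bool :=
  if i % (2 * k) < k then decide (i % (2 * k) % 2 = 1) else decide (i % (2 * k) % 2 = 0)

/-- Colours of `altColouring` on the first half. -/
theorem col_alt_of_lt {k i : ℕ} (hi : i < k) :
    col k (altColouring k) i = decide (i % 2 = 1) := by
  have h2 : i < 2 * k := by omega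
  simp [col, altColouring, Nat.mod_eq_of_lt h2, hi]

/-- Colours of `altColouring` on the second half. -/
theorem col_alt_of_ge {k i : ℕ} (hk : k ≤ i) (hi : i < 2 * k) :
    col k (altColouring k) i = decide (i % 2 = 0) := by
  simp [col, altColouring, Nat.mod_eq_of_lt hi, Nat.not_lt.2 hk]

/-- `chg a b = 1` iff the colours differ. -/
theorem chg_eq_one_iff (a b : Bool) : chg a b = 1 ↔ a ≠ b := by
  unfold chg; split_ifs with h <;> simp [h]

/-- `chg a b = 0` iff the colours agree. -/
theorem chg_eq_zero_iff (a b : Bool) : chg a b = 0 ↔ a = b := by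
  unfold chg; split_ifs with h <;> simp [h]

/-- consecutive integers have different parities, as Booleans -/
theorem decide_succ_mod_two (i : ℕ) (r : ℕ) (hr : r < 2) :
    decide ((i + 1) % 2 = r) ≠ decide (i % 2 = r) := by
  rcases Nat.mod_two_eq_zero_or_one i with h | h <;>
    interval_cases r <;> simp [Nat.succ_mod_two_eq_zero_iff, Nat.succ_mod_two_eq_one_iff, h]

/-- **The alternating colouring cuts `3k − 2` edges** (`k` even, `k ≥ 2`): every rung and every cycle
edge except `{k−1, k}` and `{2k−1, 0}`. -/
theorem cut_altColouring (k : ℕ) (hk : Even k) (hk2 : 2 ≤ k) :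
    cut k (altColouring k) = 3 * k - 2 := by
  obtain ⟨j, rfl⟩ := hk   -- k = j + j
  set k := j + j with hkdef
  have hk0 : 0 < k := by omega
  -- rung terms: all 1
  have hR : ∀ t, t < k → chg (col k (altColouring k) t) (col k (altColouring k) (t + k)) = 1 := by
    intro t ht
    rw [col_alt_of_lt ht, col_alt_of_ge (by omega) (by omega), chg_eq_one_iff]
    have : (t + k) % 2 = t % 2 := by rw [hkdef, show t + (j + j) = t + 2 * j by ring]; simp
    rw [this]
    rcases Nat.mod_two_eq_zero_or_one t with h | h <;> simp [h]
  have hRsum : rungCut k (altColouring k) = k := by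
    unfold rungCut
    rw [sum_congr rfl (fun t ht => hR t (mem_range.1 ht))]
    simp
  -- cycle terms
  have hC1 : ∀ t, t + 1 < k →
      chg (col k (altColouring k) t) (col k (altColouring k) (t + 1)) = 1 := by
    intro t ht
    rw [col_alt_of_lt (by omega), col_alt_of_lt ht, chg_eq_one_iff]
    exact (decide_succ_mod_two t 1 (by norm_num)).symm
  have hCk1 : chg (col k (altColouring k) (k - 1)) (col k (altColouring k) (k - 1 + 1)) = 0 := by
    rw [col_alt_of_lt (by omega), show k - 1 + 1 = k by omega, col_alt_of_ge le_rfl (by omega),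
      chg_eq_zero_iff]
    have h1 : (k - 1) % 2 = 1 := by omega
    have h2 : k % 2 = 0 := by omega
    simp [h1, h2]
  have hC2 : ∀ t, t + 1 < k →
      chg (col k (altColouring k) (k + t)) (col k (altColouring k) (k + t + 1)) = 1 := by
    intro t ht
    rw [col_alt_of_ge (by omega) (by omega), col_alt_of_ge (by omega) (by omega), chg_eq_one_iff]
    exact (decide_succ_mod_two (k + t) 0 (by norm_num)).symm
  have hC2k : chg (col k (altColouring k) (k + (k - 1))) (col k (altColouring k) (k + (k - 1) + 1))
      = 0 := by
    rw [col_alt_of_ge (by omega) (by omega), show k + (k - 1) + 1 = 0 + 2 * k by omega,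
      col_add_period, col_alt_of_lt hk0, chg_eq_zero_iff]
    have h1 : (k + (k - 1)) % 2 = 1 := by omega
    simp [h1]
  have hrange : range k = range (k - 1 + 1) := by rw [Nat.sub_add_cancel hk0]
  have hS1 : ∑ t ∈ range k, chg (col k (altColouring k) t) (col k (altColouring k) (t + 1)) = k - 1 := by
    rw [hrange, sum_range_succ, hCk1,
      sum_congr rfl (fun t ht => hC1 t (by have := mem_range.1 ht; omega))]
    simp
  have hS2 : ∑ t ∈ range k, chg (col k (altColouring k) (k + t)) (col k (altColouring k) (k + t + 1))
      = k - 1 := by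
    rw [hrange, sum_range_succ, hC2k,
      sum_congr rfl (fun t ht => hC2 t (by have := mem_range.1 ht; omega))]
    simp
  have hCsum : cycleCut k (altColouring k) = 2 * k - 2 := by
    unfold cycleCut
    rw [two_mul, sum_range_add, hS1, hS2]
    omega
  unfold cut
  rw [hCsum, hRsum]
  omega

/-! ### 5. The maximum cut -/

/-- `cut` depends on the colouring only through the colours of the `2k` vertices. -/
theorem cut_congr {k : ℕ} {x x' : ℕ → Bool} (h : ∀ i, col k x i = col k x' i) : cut k x = cut k x' := by
  simp only [cut, cycleCut, rungCut, h]

/-- Periodic extension of a colouring of the `2k` vertices `Fin (2k)`. -/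
def ext (k : ℕ) (y : Fin (2 * k) → Bool) (i : ℕ) : Bool :=
  if h : i % (2 * k) < 2 * k then y ⟨i % (2 * k), h⟩ else false

/-- **MAX-CUT of the Möbius ladder `M_{2k}`**: the largest cut over all `2^{2k}` two-colourings of its
vertices. -/
def maxCut (k : ℕ) : ℕ := (Finset.univ : Finset (Fin (2 * k) → Bool)).sup fun y => cut k (ext k y)

/-- Every colouring's cut is at most `maxCut`. -/
theorem cut_ext_le_maxCut (k : ℕ) (y : Fin (2 * k) → Bool) : cut k (ext k y) ≤ maxCut k :=
  Finset.le_sup (f := fun y => cut k (ext k y)) (Finset.mem_univ y)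

/-- The alternating colouring as a colouring of `Fin (2k)`, and its extension has the same colours as
`altColouring k`. -/
def altFin (k : ℕ) : Fin (2 * k) → Bool := fun i => altColouring k i.1

/-- The extension of `altFin k` has the same vertex colours as `altColouring k`. -/
theorem col_ext_altFin (k : ℕ) (hk : 0 < k) (i : ℕ) :
    col k (ext k (altFin k)) i = col k (altColouring k) i := by
  have h : i % (2 * k) < 2 * k := Nat.mod_lt _ (by omega)
  simp [col, ext, altFin, altColouring, h]

/-- **`maxcut(M_{2k}) = 3k − 2` for even `k ≥ 2`.** -/
theorem maxCut_eq (k : ℕ) (hk : Even k) (hk2 : 2 ≤ k) : maxCut k = 3 * k - 2 := by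
  apply le_antisymm
  · exact Finset.sup_le fun y _ => cut_le_of_even k hk hk2 (ext k y)
  · have h := cut_ext_le_maxCut k (altFin k)
    rw [cut_congr (col_ext_altFin k (by omega)), cut_altColouring k hk hk2] at h
    exact h

/-- **The 1000-node instance of [Wang et al. 2025, Fig. 2c]: `maxcut(M_1000) = 1498`** — the printed
"theoretical best solution (1498)" is the closed form `3·500 − 2`, attained by `altColouring 500`. -/
theorem maxCut_mobius_1000 : maxCut 500 = 1498 := by
  rw [maxCut_eq 500 ⟨250, rfl⟩ (by norm_num)]

/-- … and the optimum is attained by the explicit alternating colouring. -/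
theorem cut_altColouring_500 : cut 500 (altColouring 500) = 1498 := by
  rw [cut_altColouring 500 ⟨250, rfl⟩ (by norm_num)]

end Summit.QuantumAdvantage.Dequantization.MobiusLadderMaxCut
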